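import Summits.RiemannHypothesis.RiemannHypothesis.Theorems.WeilFormatCDataO100FrontData
import Summits.RiemannHypothesis.RiemannHypothesis.Theorems.S2FormatCE0
import Literature.NumberTheory.LFunctions.YoshidaWindowGramTailMSSines
import Literature.NumberTheory.LFunctions.YoshidaWindowGramMiddleJBox
import Literature.NumberTheory.LFunctions.YoshidaWindowGramTailJFactoredScaled
import Literature.NumberTheory.LFunctions.YoshidaWindowGramTailMSFactored
import Literature.NumberTheory.LFunctions.YoshidaWindowGramTailJDiagTight
import Summits.RiemannHypothesis.RiemannHypothesis.Theorems.FormatCPsdBands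
import Summits.RiemannHypothesis.RiemannHypothesis.Theorems.WeilFormatCDiagShift
import HarnessLib

/-!
# Format C kernel rung `O100` (a = 1/1, column-band layout): front-door constants, far-diagonal endpoints, tail bases and the reciprocal column weights of both sectors (kernel certificates; blocks B = 32/192, B₃ = 64/384 (K = 32/192 certified columns))

Window `a = 1/1`; prime powers in the window: 2, 3, 2^2, 5, 7; prime constant A = 2027/1000 (`WeilFormatC.primeCoeff_form_ge_cells_one_v2`); evaluator parameters S = 2^256, Kpi 130, Kser 150, kred 8, Kexp 45, J 120; full table modes < 193; light column table modes < 1027; units 2^-250 (Schur entries), 2^-124 (column digits, width 127), 2^-118 (tail-factor digits, width 121), 2^-64 (reciprocal weights), 2^-40 (tail base); order-J tail J = 4, θ = 1/2048, η = 1/10 | 4/1.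
Design row: sr-gb-rung-a A g23 odd λ-run (parity cell 12 L-side): a = 1, μ = 2^-88, odd 192/384/1024, MS tail, five prime powers; see HOME(A)/LADDER-LSIDES-FORMATC-A-g22.md and <A g23 folder>/NOTES.md. Generated by sr-gb-rung-a prover A g22 with rh-explicit-weil-2 gen7's generator extended for the odd λ-run (--sector odd --mu-log2; HOME(A)/code-g22/gen7/gramgen7.py sha16 a23c12b0192f5d01) from `#eval` of the tree's `Encl` functions; every datum is re-verified by the kernel in the theorem files (`decide +kernel`). Helper data of the rh-explicit Weil-positivity programme (format C, K-CELL-2), RH-free. [cite: Yoshida1992HermitianForms, §5 (5.15)-(5.16) p. 301; §7 pp. 305–312]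
-/

set_option linter.dupNamespace false
set_option maxRecDepth 200000

namespace Summit.RiemannHypothesis.RiemannHypothesis.Theorems.WeilFormatCData.O100
open Literature.NumberTheory.LFunctions Literature.NumberTheory.LFunctions.Yoshida1992 Encl Literature.Analysis.ValidatedNumerics.NumericsMP

/-- kernel: the front-door constants (and floors) are valid. -/
theorem tF : checkFDConsts O100.prm O100.C 5 O100.ns O100.F = true := by decide +kernel

/-- kernel: `√(8/Bo) ≤ 214041/1048576`. -/
theorem tSqO : checkSqrtUpper 8 O100CBOdd.B 214041 1048576 = true := by decide +kernel

/-- kernel: `0 < core⁻_A(192) − π/4 − …` (box endpoint). -/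
theorem t0O : 0 < (devOddBox (2 ^ 256) O100.C O100.FA (tget O100.ctab (192 + 1)) 192 192 214041 1048576).lo := by decide +kernel

/-- kernel: the odd tail base `d₀ = 1420155797569·2^-40`. -/
theorem tDO : (1420155797569 : ℤ) * ((2 ^ 256 : ℕ) : ℤ) ≤ (devOddBox (2 ^ 256) O100.C O100.FA (tget O100.ctab (1024 + 1)) 1024 192 214041 1048576).lo * 2 ^ 40 := by decide +kernel

/-- kernel: the Schur bands' weights are the prefix of the certified list (odd). -/
theorem tVwO : O100CBOdd.vw.take 192 = O100CBOdd.v := by decide +kernel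

/-- kernel: the sine lower-bound data are certified. -/
theorem tSines : checkSines O100.prm O100.C O100.ks O100.csd O100.sd1 O100.sdm O100.sdp = true := by decide +kernel

/-- kernel: shape of the odd weight list. -/
theorem tVo : O100CBOdd.v.length = 192 ∧ sumList O100CBOdd.v = O100CBOdd.V := by decide +kernel

end Summit.RiemannHypothesis.RiemannHypothesis.Theorems.WeilFormatCData.O100
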